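import Literature.MathematicalPhysics.QuantumFieldTheory.Balaban1983to89.B2Prop31MinimizerFamily

/-!
# `Balaban1983to89.B2Prop31MinimizerFamilyK` — [Balaban1982Higgs2] Proposition 3.1 (3.26) p. 589 for the family with the PRINTED
minimizers (3.3) and the PRINTED restrictions (2.55): the carrier of p23 g11's `B2Prop31MinimizerFamily` (p314111) CORRECTED to ask the
(2.44) cut-off data `ζ^{(k)}` exactly at the levels `1 ≤ k ≤ K` at which (3.3) forms a minimizer — `RMultiMK` ⊇ `RMultiM`

statement-level skeleton of published theorems with citation tags; proofs where landed; nothing here is a claim about the Yang–Mills mass gap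

CITATION HEADER.  T. Bałaban, *(Higgs)₂,₃ quantum fields in a finite volume. II. An upper bound*, Commun. Math. Phys. **86**
(1982) 555–594 [Balaban1982Higgs2] (PDF held `paper:balaban1982-cmp86-higgs23-ii`, journal page = PDF page + 554; pp. 558, 566, 570–571,
583, 589 on the ×2 renders `run/shared/lean/pub/pub-balaban/b2b-balaban-ref1/pages/1982-cmp86-higgs23-II/…-p004/p012/p016/p017/p029/p035-x2.png`).
Cell `lit-balaban` (HOME `run/shared/lean/pub/lit-balaban/`), Phase-2 proof seat **p23** gen 12 (unit `lit-balaban-p23-g12`; TAKING line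
HOME/STATUS.md 2026-08-22T02:39:47Z).  SKELETON rows **B2.Prop3.1** (decl of record `B2.Prop31Printed`, owner r02), **B2.Eq3.29**,
**B2.Eq2.44**; second reader r14, referee ref-4.  USED BY NAME, NOTHING RESTATED: p23 g11 `B2Prop31MinimizerFamily.{MinConsts, MinConsts.*,
Lemma23Bounds, exists_lemma23Bounds, lemma23_thresholds, RMultiM, minP31Fam, min329Fam}` (p314111), p23 g10 `B2Prop31PrintedRestrictions.
{RMultiP, RMultiP.restricted, printedP31Fam, printed329Fam, prop31Printed_thresholds, ineq329Printed_thresholds}` (p310287), `B2Prop31Thresholds.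
{thr259, thr260, SmallEps}` (p309542), r14 `B2Lemma23HiggsLattice.cutMin` (p312208), the typer's carriers, b2b's `B2.{Params, rFn, Prop31Printed,
Ineq329Printed}`.

WHY THIS FILE (the defect of the gen-11 carrier, in Lean: §1).  `B2Prop31MinimizerFamily.RMultiM` carries the cut-offs `ζ^{(k)}` as data
with the four (2.44) clauses (`|ζ| ≤ 1`, support radius `r(Lᵏε)`, plateau `½r(Lᵏε)`, Lipschitz `L^{−k}` per fine step) quantified over
EVERY `k : ℕ`.  The print defines `ζ^{(k)}` for the steps `k = 1, …, K` only ((2.44) p. 566 inside the inductive description after `k`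
steps; (3.3) p. 583 `A^{(k),ε}`, `k = 1, …, K`), where `Lᵏε ≤ ε₀ ≤ 1` and `r(Lᵏε) = R(1 + log(Lᵏε)⁻¹)^r ≥ R`.  For `k > K` the number
`r(Lᵏε)` is meaningless — `1 + log(Lᵏε)⁻¹` becomes negative and Lean's real power of a negative base is `|·|^r cos(πr)`: e.g.
`r(s) = 0` for every `s > e` when `r = 3/2` (§1 `rFn_three_halves_eq_zero`) — and at a level whose radius lies in `[0, 1)` NO function has
the four clauses once the `k`-block label moves under some fine step (§1 `no_cutoff244_of_radius_lt_one`: plateau forces `ζ(x, x_k) = 1`,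
support forces `ζ(x + εe_ν, x_k) = 0`, contradicting Lipschitz `L^{−k} < 1`).  Hence the gen-11 family is THINNER than the print's (for
`r = 3/2` it contains NO instance on any torus with a side `2L_μ > eL`: the least level `k ≥ 1` with `Lᵏε > e` has `Lᵏε ≤ eL < 2L_μ`,
so `r(Lᵏε) = 0` while the `k`-block label `⌊x_μ/Lᵏ⌋` still moves); its theorems
`prop31Printed_minimizers` / `ineq329Printed_minimizers` are true but quantify over too few instances.  THIS FILE's `RMultiMK` asks the
four clauses for `1 ≤ k ≤ K` only; everything else — the (3.3) minimizers `A`, the field (3.2), the printed restrictions `restrictedM`,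
the derivation `restricted_toRMultiP` of the gen-10 inputs (2.59)_k/(2.60)_k via r14's Lemma 2.3, and the two theorems — is re-derived
by the SAME proofs (which only ever used the levels `1 ≤ k ≤ K`), and `RMultiM.toK` embeds the old family (`minP31Fam i = minP31FamK i.toK`
definitionally).  Non-vacuity at `K ≥ 1` with a non-zero field is the sibling `B2Prop31MinimizerWitness` (same seat), using the (2.44)
construction `B2Eq244Cutoff.zeta244`.

WHAT THIS MODULE PROVES (kernel-checked, 0 `sorry`, standard axioms; definitions with bodies: `RMultiMK`, `RMultiMK.A`, `.field`,
`.toRMultiP`, `.restrictedM`, `minP31FamK`, `min329FamK`, `RMultiM.toK`; no `Prop` facts).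
 §1 `rFn_three_halves_eq_zero`, `no_cutoff244_of_radius_lt_one` (the defect);
 §2 `RMultiMK` and its API (`A`, `A_apply`, `field`, `toRMultiP`, `toRMultiP_field`, `restrictedM`, `mesh_le_eps0`,
    `blockIter_mem_L2_of_mem_pieceF`, **`restricted_toRMultiP`**);
 §3 `minP31FamK`, `minP31FamK_eq`, `min329FamK`, **`prop31Printed_minimizersK`**, **`ineq329Printed_minimizersK`** (same constants and
    hypotheses as gen 11: `∃ R₀ = 2/δ, c₃, c₅ ∀ Q (Q.d = d ∈ {2,3}, Q.L = L odd > 1, Q.a = a, Q.R ≥ R₀, Q.r ≥ 1, κ₀ < 2 − d/2),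
    SmallEps d L (Γ.toConsts c₃ c₅) ⇒ ∀ m² > 0 (≥ 0), B2.Prop31Printed Q (minP31FamK Q Γ m²)` / `B2.Ineq329Printed Q.κ₀ (min329FamK …)`);
 §4 the embedding `RMultiM.toK`, `toK_A`, `toK_field`, `toK_restrictedM`, `toK_toRMultiP`, `minP31Fam_eq_toK`, `min329Fam_eq_toK`.
HONEST SCOPE = gen 11's (i)–(vi), (viii) verbatim (integrated reading of (2.55)₁; regions and their nesting/nbhd/slice hypotheses are
READINGS of (2.7)–(2.8) carried as fields; support radius `≤ r(Lᵏε)` vs print `< r(Lᵏε) − 2M`; zero external field, torus sub-family,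
`d = 2, 3`; constants through r14's `(δ, C₁, C₂)`); (vii) non-vacuity: see `B2Prop31MinimizerWitness`.  No row head changes are claimed
(owner r02).  Nothing here is summit progress.
-/

noncomputable section

open Finset Real
open scoped BigOperators

namespace Literature.MathematicalPhysics.QuantumFieldTheory.Balaban1983to89.B2Prop31MinimizerFamilyK

open Literature.MathematicalPhysics.QuantumFieldTheory.Balaban1983to89.HiggsLattice
open Literature.MathematicalPhysics.QuantumFieldTheory.Balaban1983to89.HiggsAveraging
open Literature.MathematicalPhysics.QuantumFieldTheory.Balaban1983to89.HiggsCovariance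
open Literature.MathematicalPhysics.QuantumFieldTheory.Balaban1983to89.HiggsCovariancePos
open Literature.MathematicalPhysics.QuantumFieldTheory.Balaban1983to89.B2Eq337ScalarIntegration
open Literature.MathematicalPhysics.QuantumFieldTheory.Balaban1983to89.B2Eq325ConcreteSchur
open Literature.MathematicalPhysics.QuantumFieldTheory.Balaban1983to89.B2Ineq327ConcreteNeumann
open Literature.MathematicalPhysics.QuantumFieldTheory.Balaban1983to89.B2Eq328ConcretePieces
open Literature.MathematicalPhysics.QuantumFieldTheory.Balaban1983to89.B2Eq328DeltaK
open Literature.MathematicalPhysics.QuantumFieldTheory.Balaban1983to89.B2Ineq329ZeroAveraging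
open Literature.MathematicalPhysics.QuantumFieldTheory.Balaban1983to89.B2Prop31ZeroFieldConcrete
open Literature.MathematicalPhysics.QuantumFieldTheory.Balaban1983to89.B2Eq255Concrete (barA barA_zero)
open Literature.MathematicalPhysics.QuantumFieldTheory.Balaban1983to89.B2Ineq329RegularField
open Literature.MathematicalPhysics.QuantumFieldTheory.Balaban1983to89.B2Eq324NestedRegions
open Literature.MathematicalPhysics.QuantumFieldTheory.Balaban1983to89.B2Eq32FieldRegularity
open Literature.MathematicalPhysics.QuantumFieldTheory.Balaban1983to89.B2Prop31Thresholds
open Literature.MathematicalPhysics.QuantumFieldTheory.Balaban1983to89.B2Prop31PrintedRestrictions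
open Literature.MathematicalPhysics.QuantumFieldTheory.Balaban1983to89.B3MultiscaleFields (toSite ofSite zeroCharge)
open Literature.MathematicalPhysics.QuantumFieldTheory.Balaban1983to89.B2Lemma23HiggsLattice (cutMin lemma23_higgsLattice)
open Literature.MathematicalPhysics.QuantumFieldTheory.Balaban1983to89.B1Eq211ZeroFieldTorus (Shape)
open Literature.MathematicalPhysics.QuantumFieldTheory.Balaban1983to89.B2Prop31MinimizerFamily
  (MinConsts Lemma23Bounds exists_lemma23Bounds lemma23_thresholds RMultiM minP31Fam min329Fam)
open B2Sect2BDensities (Nested)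

/-! ## §1 The defect of the gen-11 carrier: the radius `r(Lᵏε)` above level `K`, and no cut-off for a radius in `[0, 1)` -/

/-- `r(s) = R(1 + log s⁻¹)^{3/2} = 0` for every `s > e` (the real power of the NEGATIVE base `1 + log s⁻¹ = 1 − log s` is
`|·|^{3/2}cos(3π/2) = 0`): the number `r(Lᵏε)` is meaningless at levels `k` with `Lᵏε > e`, i.e. above the stopping scale.
[cite: Balaban1982Higgs2, (2.7) p.558] -/
theorem rFn_three_halves_eq_zero (R : ℝ) {s : ℝ} (hs : Real.exp 1 < s) : B2.rFn R (3 / 2) s = 0 := by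
  unfold B2.rFn
  have hs0 : 0 < s := lt_trans (Real.exp_pos 1) hs
  have hlog : 1 < Real.log s := by
    rw [← Real.log_exp 1]
    exact Real.log_lt_log (Real.exp_pos 1) hs
  have hneg : 1 + Real.log s⁻¹ < 0 := by rw [Real.log_inv]; linarith
  rw [Real.rpow_def_of_neg hneg]
  have hcos : Real.cos (3 / 2 * Real.pi) = 0 := by
    have : 3 / 2 * Real.pi = Real.pi / 2 + Real.pi := by ring
    rw [this, Real.cos_add_pi, Real.cos_pi_div_two, neg_zero]
  rw [hcos, mul_zero, mul_zero]

/-- **No (2.44) cut-off exists for a radius `ρ ∈ [0, 1)` at a level `k ≥ 1` of a torus with `L > 1` whose `k`-block label moves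
under some fine step** (`|x_k − (x + εe_ν)_k| ≥ 1` for some `x`, `ν`): the plateau clause gives `ζ(x, x_k) = 1`, the support clause
gives `ζ(x + εe_ν, x_k) = 0`, and `1 ≤ L^{−k}` is false.  (The four clauses are those of `B2Prop31MinimizerFamily.RMultiM.ζ_*` at level
`k`.) [cite: Balaban1982Higgs2, (2.44) p.566] -/
theorem no_cutoff244_of_radius_lt_one {P : HiggsLattice.Params} (hL : 1 < P.L) {k : ℕ} (hk : 1 ≤ k) {ρ : ℝ} (hρ0 : 0 ≤ ρ)
    (hρ1 : ρ < 1) {x : HiggsLattice.Site P 0} {ν : Fin P.d}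
    (hmove : 1 ≤ HiggsLattice.Site.tdist (blockIter k (x.shift ν)) (blockIter k x)) :
    ¬ ∃ ζ : HiggsLattice.Site P 0 → HiggsLattice.Site P k → ℝ,
        (∀ x y', |ζ x y'| ≤ 1)
        ∧ (∀ x y', ζ x y' ≠ 0 → (HiggsLattice.Site.tdist (blockIter k x) y' : ℝ) ≤ ρ)
        ∧ (∀ x y', (HiggsLattice.Site.tdist (blockIter k x) y' : ℝ) ≤ ρ / 2 → ζ x y' = 1)
        ∧ (∀ (x : HiggsLattice.Site P 0) (ν : Fin P.d) (y' : HiggsLattice.Site P k),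
            |ζ (x.shift ν) y' - ζ x y'| ≤ ((P.L : ℝ) ^ k)⁻¹) := by
  rintro ⟨ζ, -, hsupp, hone, hlip⟩
  have h1 : ζ x (blockIter k x) = 1 := by
    apply hone
    rw [B1Ineq234Concrete.tdist_self, Nat.cast_zero]
    linarith
  have h0 : ζ (x.shift ν) (blockIter k x) = 0 := by
    by_contra h
    have h' := hsupp _ _ h
    have h'' : (1 : ℝ) ≤ (HiggsLattice.Site.tdist (blockIter k (x.shift ν)) (blockIter k x) : ℝ) := by exact_mod_cast hmove
    linarith
  have hl := hlip x ν (blockIter k x)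
  rw [h0, h1, zero_sub, abs_neg, abs_one] at hl
  have hLk : (1 : ℝ) < (P.L : ℝ) ^ k := by
    have hLr : (1 : ℝ) < P.L := by exact_mod_cast hL
    exact one_lt_pow₀ hLr (by omega)
  have : ((P.L : ℝ) ^ k)⁻¹ < 1 := inv_lt_one_of_one_lt₀ hLk
  linarith

/-! ## §2 The corrected carrier `RMultiMK`: (2.44) data at the levels `1 ≤ k ≤ K` -/

/-- **One instance of Proposition 3.1 with the (3.3) minimizers and the (2.55) restrictions** — the data of p23 g11's `RMultiM`
(lattice member of the torus sub-family, steps `K ≤` the lattice's, stopping rule `Lᴷε ≤ ε₀`, tower of regions, charge data, cut-offs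
`θ_k` with their printed properties, `A₀`, block vector fields `A_k`, configuration `Φ`, the regions `Λ₂ ⊆ Λ₁` per level with the nbhd /
`Λ₅ ⊂ Λ₂` / slice READINGS of (2.7)–(2.8)) with the (2.44) cut-offs `ζ^{(k)}` and their four printed properties (`|ζ| ≤ 1`, support radius
`r(Lᵏε)`, plateau `½r(Lᵏε)`, Lipschitz `L^{−k}` per fine step) required FOR `1 ≤ k ≤ K` ONLY — the steps at which (2.44)/(3.3) forms the
minimizer `A^{(k),ε}`. [cite: Balaban1982Higgs2, Prop. 3.1 p.589, (3.2)–(3.3) p.583, (2.44) p.566, (2.55) p.570, (2.7)–(2.8) p.558] -/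
structure RMultiMK (Q : B2.Params) (Γ : MinConsts) (m2 : ℝ) where
  /-- the lattice family member (tori `T^{(k)}_{Lᵏε}`) -/
  P : HiggsLattice.Params
  hL : P.L = Q.L
  hd : P.d = Q.d
  /-- the torus sub-family `M·L′_μ = Lᵐ`, `L` odd (r14's/p14's decay bounds) -/
  S : Shape P
  /-- number of real scalar-field components -/
  N : ℕ
  /-- number of renormalization steps -/
  K : ℕ
  hK : K ≤ P.K
  /-- the stopping rule `Lᴷε ≤ ε₀` (p. 582) -/
  hε₀ : P.mesh K ≤ Γ.ε₀
  /-- the tower of large-field regions `Λ₅⁽ᵏ⁾` -/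
  T : Tower P K
  C : ChargeData N
  /-- the model's coupling constant -/
  hCe : C.e = Γ.e
  /-- the cut-offs `θ_k` on the fine torus, with their printed properties (as in `RMultiP`) -/
  θ : ℕ → HiggsLattice.Site P 0 → ℝ
  θ_nested : Nested θ
  θ_range : ∀ m (z : HiggsLattice.Site P 0), 0 ≤ θ m z ∧ θ m z ≤ 1
  θ_one : ∀ k, 1 ≤ k → k ≤ K → ∀ z : HiggsLattice.Site P 0, T.lamAt (k - 1) z → θ k z = 1 ∧ ∀ ν, θ k (z.shift ν) = 1
  θ_zero : ∀ k, k + 2 ≤ K → ∀ z : HiggsLattice.Site P 0,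
    (θ (k + 2) z ≠ 0 ∨ ∃ ν, θ (k + 2) (z.shift ν) ≠ 0) → T.lamAt k z
  θ_above : ∀ m, K < m → ∀ z : HiggsLattice.Site P 0, θ m z = 0
  θ_lip : ∀ k (z : HiggsLattice.Site P 0) (ν : Fin P.d), |θ (k + 1) (z.shift ν) - θ (k + 1) z| ≤ Γ.cθ * ((P.L : ℝ) ^ k)⁻¹
  /-- `A₀` of (3.2) -/
  A₀ : HiggsLattice.VecField P 0
  /-- the block vector fields `A_k` on `T⁽ᵏ⁾` -/
  Ac : (k : ℕ) → HiggsLattice.VecField P k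
  /-- the configuration `Φ` of (3.24) -/
  Φ : Cfg T.regions N
  /-- the cut-offs `ζ^{(k)}(x, y′)` of (2.44), `y′` a block label of `T⁽ᵏ⁾` (only `1 ≤ k ≤ K` matter) -/
  ζ : (k : ℕ) → HiggsLattice.Site P 0 → HiggsLattice.Site P k → ℝ
  ζ_abs : ∀ k, 1 ≤ k → k ≤ K → ∀ x y', |ζ k x y'| ≤ 1
  /-- support radius `r(Lᵏε)` (print: `< r(Lᵏε) − 2M`), steps `1 ≤ k ≤ K` -/
  ζ_supp : ∀ k, 1 ≤ k → k ≤ K → ∀ x y', ζ k x y' ≠ 0 →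
    (HiggsLattice.Site.tdist (blockIter k x) y' : ℝ) ≤ B2.rFn Q.R Q.r (P.mesh k)
  /-- plateau radius `½r(Lᵏε)`, steps `1 ≤ k ≤ K` -/
  ζ_one : ∀ k, 1 ≤ k → k ≤ K → ∀ x y',
    (HiggsLattice.Site.tdist (blockIter k x) y' : ℝ) ≤ B2.rFn Q.R Q.r (P.mesh k) / 2 → ζ k x y' = 1
  /-- *"|(∂^η_xζ^{(k)})(b, y)| ≦ 1"*: Lipschitz `L^{−k}` per fine step, steps `1 ≤ k ≤ K` -/
  ζ_lip : ∀ k, 1 ≤ k → k ≤ K → ∀ (x : HiggsLattice.Site P 0) (ν : Fin P.d) (y' : HiggsLattice.Site P k),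
    |ζ k (x.shift ν) y' - ζ k x y'| ≤ ((P.L : ℝ) ^ k)⁻¹
  /-- the `Λ₁`-region of level `k` (print: `Λ₋₁⁽ᵏ⁻¹⁾′`), where (2.55) holds -/
  L1 : (k : ℕ) → Finset (HiggsLattice.Site P k)
  /-- the `Λ₂`-region of level `k` (print: `Λ₂⁽ᵏ⁻¹⁾′`), over which (2.59)/(2.60) are used -/
  L2 : (k : ℕ) → Finset (HiggsLattice.Site P k)
  L2_sub : ∀ k, L2 k ⊆ L1 k
  /-- the range of `ζ^{(k)}` (+1) around `Bᵏ(Λ₂-region)` lies in the `Λ₁`-region -/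
  nbhd : ∀ k x y', blockIter k x ∈ L2 k →
    (HiggsLattice.Site.tdist (blockIter k x) y' : ℝ) ≤ B2.rFn Q.R Q.r (P.mesh k) + 1 → y' ∈ L1 k
  /-- `Λ₅⁽ʲ⁾′ ⊆ Λ₂-region of level j + 1` (print: `Λ₅ ⊂ Λ₂`) -/
  lam_sub : ∀ j, j < K → B2Eq324NestedRegions.prime (T.lam j) ⊆ L2 (j + 1)
  /-- the `θ_{j+2}`-slice lies within `Bʲ⁺²(Λ₂-region of level j + 2)` -/
  slice_sub : ∀ j (z : HiggsLattice.Site P 0) (ν : Fin P.d),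
    (θ (j + 2) z ≠ 0 ∨ θ (j + 2) (z.shift ν) ≠ 0) → blockIter (j + 2) z ∈ L2 (j + 2)

namespace RMultiMK

variable {Q : B2.Params} {Γ : MinConsts} {m2 : ℝ}

/-- **THE MINIMIZERS (3.3) OF THE INSTANCE**: `A^{(k),ε} = a_k(Lᵏε)^{−2}ζ^{(k)}G^ε_kQ*_kA_k` — r14's `cutMin` at the trivial coupling
(the vector-field case, `N = d`), read back as a bond function. [cite: Balaban1982Higgs2, (3.3) p.583] -/
def A (i : RMultiMK Q Γ m2) (k : ℕ) : HiggsLattice.VecField i.P 0 :=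
  ofSite (cutMin (zeroCharge i.P.d) Γ.μ0sq Q.a k (i.ζ k) (toSite (i.Ac k)))

/-- Pointwise: `A^{(k),ε}(⟨x, μ⟩) = (cutMin … (toSite A_k))(x)_μ` (definitional). [cite: Balaban1982Higgs2, (3.3) p.583] -/
theorem A_apply (i : RMultiMK Q Γ m2) (k : ℕ) (x : HiggsLattice.Site i.P 0) (μ : Fin i.P.d) :
    i.A k ⟨x, μ⟩ = cutMin (zeroCharge i.P.d) Γ.μ0sq Q.a k (i.ζ k) (toSite (i.Ac k)) x μ := rfl

/-- **The field `Ã^ε` of the instance**: (3.2) built from the cut-offs, `A₀` and the (3.3) minimizers. [cite: Balaban1982Higgs2, (3.2) p.583] -/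
def field (i : RMultiMK Q Γ m2) : HiggsLattice.VecField i.P 0 := field32 i.θ i.A₀ i.A i.K

/-- **The map to the gen-10 carrier**: the same data, the minimizers SUPPLIED by (3.3); the gen-10 constants with any `c₃`, `c₅`.
[cite: Balaban1982Higgs2, Prop. 3.1 p.589] -/
def toRMultiP (i : RMultiMK Q Γ m2) (c₃ c₅ : ℝ) : RMultiP Q (Γ.toConsts c₃ c₅) m2 where
  P := i.P
  hL := i.hL
  hd := i.hd
  N := i.N
  K := i.K
  hK := i.hK
  hε₀ := i.hε₀
  T := i.T
  C := i.C
  hCe := i.hCe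
  θ := i.θ
  θ_nested := i.θ_nested
  θ_range := i.θ_range
  θ_one := i.θ_one
  θ_zero := i.θ_zero
  θ_above := i.θ_above
  θ_lip := i.θ_lip
  A₀ := i.A₀
  A := i.A
  Ac := i.Ac
  Φ := i.Φ

/-- The image has the same field `Ã^ε` (definitional). [cite: Balaban1982Higgs2, (3.2) p.583] -/
theorem toRMultiP_field (i : RMultiMK Q Γ m2) (c₃ c₅ : ℝ) : (i.toRMultiP c₃ c₅).field = i.field := rfl

/-- **THE PRINTED RESTRICTIONS ON THE BLOCK FIELDS** (the content of the characteristic functions `χ_k` of (3.21)) — verbatim the body of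
gen 11's `RMultiM.restrictedM`: for every level `1 ≤ k ≤ K`, (2.55)₂ `‖A_k(y′)‖ ≤ c_{A1}·s_k^{−d/2}p(s_k)` on the `Λ₁`-region and (2.55)₁
(integrated) `‖A_k(y′) − A_k(y)‖ ≤ c_q·s_k^{−(d−2)/2}p(s_k)·(r₁ + r₂|y − y′|)` for `y` in the `Λ₂`-region, `y′` in the `Λ₁`-region; the
restriction (2.17)/(2.97) on `A_{k+1}(z_{k+1}) − A_k(z_k)` on the `θ_{k+1}`-slice over `Bᵏ(Λ_k)`; and (2.55)₄/(3.15)₂ `‖φ_k(y)‖ ≤ thrφ(s_k)` on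
`Λ_k`.  NO minimizer, NO (2.59)/(2.60) is assumed. [cite: Balaban1982Higgs2, Prop. 3.1 p.589, (3.21) p.588, (2.55) p.570, (2.17) p.560, (3.15) p.586] -/
def restrictedM (i : RMultiMK Q Γ m2) : Prop :=
  (∀ k, 1 ≤ k → k ≤ i.K → ∀ y' ∈ i.L1 k, ‖toSite (i.Ac k) y'‖ ≤ Γ.thrA i.P.d (i.P.mesh k))
  ∧ (∀ k, 1 ≤ k → k ≤ i.K → ∀ y ∈ i.L2 k, ∀ y' ∈ i.L1 k,
      ‖toSite (i.Ac k) y' - toSite (i.Ac k) y‖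
        ≤ Γ.thrQ i.P.d (i.P.mesh k) * (Γ.r₁ + Γ.r₂ * (HiggsLattice.Site.tdist y y' : ℝ)))
  ∧ (∀ (j : Fin i.K), ∀ z ∈ pieceF i.T.regions j, ∀ μ ν : Fin i.P.d,
      (i.θ (j.val + 2) z ≠ 0 ∨ i.θ (j.val + 2) (z.shift ν) ≠ 0) →
      |i.Ac (j.val + 2) ⟨blockIter (j.val + 2) z, μ⟩ - i.Ac (j.val + 1) ⟨blockIter (j.val + 1) z, μ⟩|
        ≤ Γ.thr217M i.P.d (i.P.mesh (j.val + 1)))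
  ∧ (∀ (j : Fin i.K) (y : LSite i.T.regions j), ‖resL i.T.regions j i.Φ y‖ ≤ Γ.thrφM i.P.d (i.P.mesh (j.val + 1)))

/-- `s_k ≤ ε₀ ≤ 1` for `k ≤ K`. [cite: Balaban1982Higgs2, p.582] -/
theorem mesh_le_eps0 (hΓ : Γ.Valid) (i : RMultiMK Q Γ m2) {k : ℕ} (hk : k ≤ i.K) : i.P.mesh k ≤ Γ.ε₀ ∧ i.P.mesh k ≤ 1 :=
  ⟨(mesh_le_mesh hk).trans i.hε₀, ((mesh_le_mesh hk).trans i.hε₀).trans hΓ.ε₀_le_one⟩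

/-- A fine point of `Bᵏ(Λ_k)` (`k = j + 1`) has its `k`-block label in `Λ₅⁽ʲ⁾′ ⊆ Λ₂-region of level k`.
[cite: Balaban1982Higgs2, (3.22)–(3.24) p.588] -/
theorem blockIter_mem_L2_of_mem_pieceF (i : RMultiMK Q Γ m2) (j : Fin i.K) {z : HiggsLattice.Site i.P 0}
    (hz : z ∈ pieceF i.T.regions j) : blockIter (j.val + 1) z ∈ i.L2 (j.val + 1) := by
  have h2 : blockIter (j.val + 1) z ∈ B2Eq324NestedRegions.prime (i.T.lam j.val) \ i.T.lam (j.val + 1) :=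
    (mem_pieceF_iff i.T.regions j z).mp hz
  exact i.lam_sub j.val j.isLt (Finset.mem_sdiff.mp h2).1

/-- **THE PRINTED RESTRICTIONS IMPLY THE GEN-10 RESTRICTIONS** for the image instance, given Lemma-2.3 constants `(δ, C₁, C₂)` for
`(d, L, a, μ₀², ε₀) = (Q.d, Q.L, Q.a, μ₀², ε₀)`, `Q.R ≥ 2/δ`, `Q.r ≥ 1`: all six conjuncts of `RMultiP.restricted` — (2.60)_k, (2.59)_k on
`Bᵏ(Λ_k)`, the two slice conjuncts at level `k + 1`, (2.17), (2.55)₄ — with `c₃ = c3Of`, `c₅ = c5Of` (gen 11's `lemma23_thresholds` at the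
levels `k` and `k + 1`, BOTH `≤ K`, where the (2.44) clauses of this carrier are available; (2.17) and (2.55)₄ carried over) — the proof of
gen 11's `RMultiM.restricted_toRMultiP` verbatim. [cite: Balaban1982Higgs2, Prop. 3.1 p.589, Lemma 2.3 p.571, (2.97)–(2.98) p.577] -/
theorem restricted_toRMultiP (hΓ : Γ.Valid) (hQa : 0 < Q.a) {δ C₁ C₂ : ℝ}
    (pkg : Lemma23Bounds Q.d Q.L Q.a Γ.μ0sq Γ.ε₀ δ C₁ C₂) (hδ : 0 < δ) (hC₂ : 0 ≤ C₂)
    (hR : 2 / δ ≤ Q.R) (hr : 1 ≤ Q.r) (i : RMultiMK Q Γ m2) (hrM : i.restrictedM) :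
    (i.toRMultiP (Γ.c3Of Q.a Q.L C₁ C₂) (Γ.c5Of C₁ C₂)).restricted := by
  obtain ⟨hsup, hvar, h217, hΦ⟩ := hrM
  -- the one-level lemma at the levels `1 ≤ k ≤ K` of the instance (where the (2.44) clauses are fields)
  have key : ∀ {k : ℕ}, 1 ≤ k → k ≤ i.K → ∀ (x : HiggsLattice.Site i.P 0), blockIter k x ∈ i.L2 k → ∀ μ ν : Fin i.P.d,
      |i.A k ⟨x, μ⟩ - i.Ac k ⟨blockIter k x, μ⟩|
          ≤ thr259 (Γ.toConsts (Γ.c3Of Q.a Q.L C₁ C₂) (Γ.c5Of C₁ C₂)) i.P.d (i.P.mesh k)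
      ∧ |i.A k ⟨x.shift ν, μ⟩ - i.A k ⟨x, μ⟩|
          ≤ thr260 (Γ.toConsts (Γ.c3Of Q.a Q.L C₁ C₂) (Γ.c5Of C₁ C₂)) i.P.d i.P.ε (i.P.mesh k) := by
    intro k hk1 hk x hx μ ν
    have hm := i.mesh_le_eps0 hΓ hk
    exact lemma23_thresholds hΓ hQa pkg hδ hC₂ i.S i.hd i.hL hR hr hk1 (hk.trans i.hK) hm.2 hm.1 (i.ζ k) (i.ζ_abs k hk1 hk)
      (i.ζ_supp k hk1 hk) (i.ζ_one k hk1 hk) (i.ζ_lip k hk1 hk) (i.L1 k) (i.L2 k) (i.L2_sub k) (i.nbhd k) (i.Ac k) (hsup k hk1 hk)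
      (hvar k hk1 hk) x hx μ ν
  -- the slice at `j` forces `j + 2 ≤ K` (`θ_m = 0` above `K`)
  have hsl_le : ∀ (j : ℕ) (z : HiggsLattice.Site i.P 0) (ν : Fin i.P.d),
      (i.θ (j + 2) z ≠ 0 ∨ i.θ (j + 2) (z.shift ν) ≠ 0) → j + 2 ≤ i.K := by
    intro j z ν hsl
    by_contra hK
    have h0 := i.θ_above (j + 2) (by omega)
    rcases hsl with h | h
    · exact h (h0 z)
    · exact h (h0 (z.shift ν))
  refine ⟨?_, ?_, ?_, ?_, ?_, ?_⟩
  · -- (2.60)_k on `Bᵏ(Λ_k)`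
    intro j z hz μ ν
    have hj : j.val < i.K := j.isLt
    exact (key (k := j.val + 1) (by omega) (by omega) z (i.blockIter_mem_L2_of_mem_pieceF j hz) μ ν).2
  · -- (2.59)_k on `Bᵏ(Λ_k)`
    intro j z hz μ
    have hj : j.val < i.K := j.isLt
    exact (key (k := j.val + 1) (by omega) (by omega) z (i.blockIter_mem_L2_of_mem_pieceF j hz) μ μ).1
  · -- (2.60)_{k+1} on the slice
    intro j z hz μ ν hsl
    have hsl' : i.θ (j.val + 2) z ≠ 0 ∨ i.θ (j.val + 2) (z.shift ν) ≠ 0 := hsl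
    exact (key (k := j.val + 2) (by omega) (hsl_le j.val z ν hsl') z (i.slice_sub j.val z ν hsl') μ ν).2
  · -- (2.59)_{k+1} on the slice
    intro j z hz μ ν hsl
    have hsl' : i.θ (j.val + 2) z ≠ 0 ∨ i.θ (j.val + 2) (z.shift ν) ≠ 0 := hsl
    exact (key (k := j.val + 2) (by omega) (hsl_le j.val z ν hsl') z (i.slice_sub j.val z ν hsl') μ ν).1
  · -- (2.17) (carried over; `thr217` does not read `c₃`, `c₅`)
    intro j z hz μ ν hsl
    have hsl' : i.θ (j.val + 2) z ≠ 0 ∨ i.θ (j.val + 2) (z.shift ν) ≠ 0 := hsl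
    have hz' : z ∈ pieceF i.T.regions j := hz
    rw [MinConsts.thr217_toConsts]
    exact h217 j z hz' μ ν hsl'
  · -- (2.55)₄ (carried over)
    intro j y
    rw [MinConsts.thrφ_toConsts]
    exact hΦ j y

end RMultiMK

/-! ## §3 The families and Proposition 3.1 / (3.29) for them -/

/-- **THE FAMILY OF `B2.P31Setting` WITH THE (3.3) MINIMIZERS OVER THE (2.55) RESTRICTIONS** (corrected carrier): `restricted := restrictedM`;
all other fields as in gen 10's `printedP31Fam` for the image instance. [cite: Balaban1982Higgs2, Prop. 3.1 (3.26)–(3.28) p.589] -/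
def minP31FamK (Q : B2.Params) (Γ : MinConsts) (m2 : ℝ) (i : RMultiMK Q Γ m2) : B2.P31Setting :=
  { printedP31Fam Q (Γ.toConsts 0 0) m2 (i.toRMultiP 0 0) with restricted := i.restrictedM }

/-- The numeric fields of `minP31FamK` are those of `printedP31Fam` at the image instance, for ANY `c₃`, `c₅` (definitional).
[cite: Balaban1982Higgs2, Prop. 3.1 p.589] -/
theorem minP31FamK_eq (Q : B2.Params) (Γ : MinConsts) (m2 : ℝ) (i : RMultiMK Q Γ m2) (c₃ c₅ : ℝ) :
    minP31FamK Q Γ m2 i = { printedP31Fam Q (Γ.toConsts c₃ c₅) m2 (i.toRMultiP c₃ c₅) with restricted := i.restrictedM } := rfl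

/-- **THE PER-SCALE (3.29) FAMILY WITH THE (3.3) MINIMIZERS OVER THE (2.55) RESTRICTIONS** (corrected carrier; `restricted := restrictedM`).
[cite: Balaban1982Higgs2, (3.29) p.590] -/
def min329FamK (Q : B2.Params) (Γ : MinConsts) (m2 : ℝ) (ij : Σ i : RMultiMK Q Γ m2, Fin i.K) : B2.I329Setting :=
  { printed329Fam Q (Γ.toConsts 0 0) m2 ⟨ij.1.toRMultiP 0 0, ij.2⟩ with restricted := ij.1.restrictedM }

/-- **PROPOSITION 3.1 (3.26) FOR THE CORRECTED FAMILY WITH THE PRINTED MINIMIZERS AND THE PRINTED RESTRICTIONS.**  For `d ∈ {2, 3}`,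
odd `L > 1`, `a > 0`, `μ₀² > 0`, `0 < ε₀ ≤ 1` there are `R₀ > 0` (*"R > R₀"* of (2.7)) and O(1)'s `c₃, c₅ ≥ 0` — functions of
`(d, L, a, μ₀², ε₀)` and of the O(1)'s of (2.55) — such that for every parameter record `Q` with `Q.d = d`, `Q.L = L`, `Q.a = a`, `Q.R ≥ R₀`,
`Q.r ≥ 1`, `Q.κ₀ < 2 − d/2`, every valid constants record `Γ` with `Γ.μ0sq = μ₀²`, `Γ.ε₀ = ε₀` whose coupling is small in the sense
`SmallEps d L (Γ.toConsts c₃ c₅)`, and every `m² > 0`, the cell's typed `B2.Prop31Printed Q` HOLDS on `minP31FamK Q Γ m²`: every instance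
whose block fields obey (2.55)/(2.17)/(2.55)₄ satisfies (3.26), its minimizers BEING (3.3) and its (2.44) cut-offs being ANY data with the
four printed properties at the steps `1 ≤ k ≤ K` (`restricted_toRMultiP` + gen 10's `prop31Printed_thresholds`); zero-field instances
satisfy it without the error. [cite: Balaban1982Higgs2, Prop. 3.1 (3.26) p.589, Lemma 2.3 p.571, (3.3) p.583, (2.44) p.566, (2.7) p.558] -/
theorem prop31Printed_minimizersK (d L : ℕ) (hd2 : 2 ≤ d) (hd3 : d ≤ 3) (hL : Odd L ∧ 1 < L) {a : ℝ} (ha : 0 < a)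
    {μ0sq : ℝ} (hμ : 0 < μ0sq) (ε₀ : ℝ) (Γ : MinConsts) (hΓ : Γ.Valid) (hΓμ : Γ.μ0sq = μ0sq) (hΓε : Γ.ε₀ = ε₀) :
    ∃ R₀ c₃ c₅ : ℝ, 0 < R₀ ∧ 0 ≤ c₃ ∧ 0 ≤ c₅ ∧
      ∀ (Q : B2.Params), Q.d = d → Q.L = L → Q.a = a → R₀ ≤ Q.R → 1 ≤ Q.r → Q.κ₀ < 2 - (d : ℝ) / 2 →
        SmallEps d L (Γ.toConsts c₃ c₅) → ∀ {m2 : ℝ}, 0 < m2 → B2.Prop31Printed Q (minP31FamK Q Γ m2) := by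
  obtain ⟨δ, C₁, C₂, hδ, hC₁, hC₂, pkg⟩ := exists_lemma23Bounds d L (by omega) hL ha hμ ε₀
  refine ⟨2 / δ, Γ.c3Of a L C₁ C₂, Γ.c5Of C₁ C₂, by positivity, MinConsts.c3Of_nonneg hΓ ha hL.2 hC₁.le hC₂.le,
    MinConsts.c5Of_nonneg hΓ hC₁.le hC₂.le, ?_⟩
  intro Q hQd hQL hQa hR hRr hκ hsm m2 hm
  subst hQd hQL hQa hΓμ hΓε
  have hΓ'v : (Γ.toConsts (Γ.c3Of Q.a Q.L C₁ C₂) (Γ.c5Of C₁ C₂)).Valid :=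
    MinConsts.toConsts_valid hΓ (MinConsts.c3Of_nonneg hΓ ha hL.2 hC₁.le hC₂.le) (MinConsts.c5Of_nonneg hΓ hC₁.le hC₂.le)
  obtain ⟨γ₀, Cc, hγ, hCc, h1, h2⟩ := prop31Printed_thresholds Q hL.2 ha hd2 hd3 hκ _ hΓ'v hsm hm
  refine ⟨γ₀, Cc, hγ, hCc, fun i hri => ?_, fun i hz => ?_⟩
  · exact h1 (i.toRMultiP (Γ.c3Of Q.a Q.L C₁ C₂) (Γ.c5Of C₁ C₂))
      (RMultiMK.restricted_toRMultiP hΓ ha pkg hδ hC₂.le hR hRr i hri)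
  · exact h2 (i.toRMultiP (Γ.c3Of Q.a Q.L C₁ C₂) (Γ.c5Of C₁ C₂)) hz

/-- **THE CELL'S TYPED (3.29) FOR THE PER-SCALE CORRECTED FAMILY** (same constants; `m² ≥ 0`): `B2.Ineq329Printed Q.κ₀ (min329FamK Q Γ m²)`.
[cite: Balaban1982Higgs2, (3.29) p.590] -/
theorem ineq329Printed_minimizersK (d L : ℕ) (hd2 : 2 ≤ d) (hd3 : d ≤ 3) (hL : Odd L ∧ 1 < L) {a : ℝ} (ha : 0 < a)
    {μ0sq : ℝ} (hμ : 0 < μ0sq) (ε₀ : ℝ) (Γ : MinConsts) (hΓ : Γ.Valid) (hΓμ : Γ.μ0sq = μ0sq) (hΓε : Γ.ε₀ = ε₀) :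
    ∃ R₀ c₃ c₅ : ℝ, 0 < R₀ ∧ 0 ≤ c₃ ∧ 0 ≤ c₅ ∧
      ∀ (Q : B2.Params), Q.d = d → Q.L = L → Q.a = a → R₀ ≤ Q.R → 1 ≤ Q.r → Q.κ₀ < 2 - (d : ℝ) / 2 →
        SmallEps d L (Γ.toConsts c₃ c₅) → ∀ {m2 : ℝ}, 0 ≤ m2 → B2.Ineq329Printed Q.κ₀ (min329FamK Q Γ m2) := by
  obtain ⟨δ, C₁, C₂, hδ, hC₁, hC₂, pkg⟩ := exists_lemma23Bounds d L (by omega) hL ha hμ ε₀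
  refine ⟨2 / δ, Γ.c3Of a L C₁ C₂, Γ.c5Of C₁ C₂, by positivity, MinConsts.c3Of_nonneg hΓ ha hL.2 hC₁.le hC₂.le,
    MinConsts.c5Of_nonneg hΓ hC₁.le hC₂.le, ?_⟩
  intro Q hQd hQL hQa hR hRr hκ hsm m2 hm
  subst hQd hQL hQa hΓμ hΓε
  have hΓ'v : (Γ.toConsts (Γ.c3Of Q.a Q.L C₁ C₂) (Γ.c5Of C₁ C₂)).Valid :=
    MinConsts.toConsts_valid hΓ (MinConsts.c3Of_nonneg hΓ ha hL.2 hC₁.le hC₂.le) (MinConsts.c5Of_nonneg hΓ hC₁.le hC₂.le)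
  obtain ⟨γ₀, Cc, hγ, hCc, h1⟩ := ineq329Printed_thresholds Q hL.2 ha hd2 hd3 hκ _ hΓ'v hsm hm
  refine ⟨γ₀, Cc, hγ, hCc, fun ij hri => ?_⟩
  obtain ⟨i, j⟩ := ij
  exact h1 ⟨i.toRMultiP (Γ.c3Of Q.a Q.L C₁ C₂) (Γ.c5Of C₁ C₂), j⟩
    (RMultiMK.restricted_toRMultiP hΓ ha pkg hδ hC₂.le hR hRr i hri)

/-! ## §4 The gen-11 family embeds: `RMultiM ↪ RMultiMK` -/

/-- **The old carrier is a sub-family of the corrected one**: forget the (2.44) clauses at the levels `k = 0` and `k > K`.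
[cite: Balaban1982Higgs2, Prop. 3.1 p.589, (2.44) p.566] -/
def _root_.Literature.MathematicalPhysics.QuantumFieldTheory.Balaban1983to89.B2Prop31MinimizerFamily.RMultiM.toK
    {Q : B2.Params} {Γ : MinConsts} {m2 : ℝ} (i : RMultiM Q Γ m2) : RMultiMK Q Γ m2 where
  P := i.P
  hL := i.hL
  hd := i.hd
  S := i.S
  N := i.N
  K := i.K
  hK := i.hK
  hε₀ := i.hε₀
  T := i.T
  C := i.C
  hCe := i.hCe
  θ := i.θ
  θ_nested := i.θ_nested
  θ_range := i.θ_range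
  θ_one := i.θ_one
  θ_zero := i.θ_zero
  θ_above := i.θ_above
  θ_lip := i.θ_lip
  A₀ := i.A₀
  Ac := i.Ac
  Φ := i.Φ
  ζ := i.ζ
  ζ_abs k _ _ := i.ζ_abs k
  ζ_supp k _ _ := i.ζ_supp k
  ζ_one k _ _ := i.ζ_one k
  ζ_lip k _ _ := i.ζ_lip k
  L1 := i.L1
  L2 := i.L2
  L2_sub := i.L2_sub
  nbhd := i.nbhd
  lam_sub := i.lam_sub
  slice_sub := i.slice_sub

section Embedding

variable {Q : B2.Params} {Γ : MinConsts} {m2 : ℝ}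

/-- Same minimizers (definitional). [cite: Balaban1982Higgs2, (3.3) p.583] -/
theorem toK_A (i : RMultiM Q Γ m2) : i.toK.A = i.A := rfl

/-- Same field `Ã^ε` (definitional). [cite: Balaban1982Higgs2, (3.2) p.583] -/
theorem toK_field (i : RMultiM Q Γ m2) : i.toK.field = i.field := rfl

/-- Same printed restrictions (definitional). [cite: Balaban1982Higgs2, Prop. 3.1 p.589, (2.55) p.570] -/
theorem toK_restrictedM (i : RMultiM Q Γ m2) : i.toK.restrictedM ↔ i.restrictedM := Iff.rfl

/-- Same image in the gen-10 carrier (definitional). [cite: Balaban1982Higgs2, Prop. 3.1 p.589] -/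
theorem toK_toRMultiP (i : RMultiM Q Γ m2) (c₃ c₅ : ℝ) : i.toK.toRMultiP c₃ c₅ = i.toRMultiP c₃ c₅ := rfl

/-- **`minP31Fam i = minP31FamK i.toK`** (definitional): gen 11's Proposition-3.1 family is the restriction of this file's to the old
carrier. [cite: Balaban1982Higgs2, Prop. 3.1 (3.26) p.589] -/
theorem minP31Fam_eq_toK (i : RMultiM Q Γ m2) : minP31Fam Q Γ m2 i = minP31FamK Q Γ m2 i.toK := rfl

/-- **`min329Fam ⟨i, j⟩ = min329FamK ⟨i.toK, j⟩`** (definitional). [cite: Balaban1982Higgs2, (3.29) p.590] -/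
theorem min329Fam_eq_toK (i : RMultiM Q Γ m2) (j : Fin i.K) : min329Fam Q Γ m2 ⟨i, j⟩ = min329FamK Q Γ m2 ⟨i.toK, j⟩ := rfl

end Embedding

end Literature.MathematicalPhysics.QuantumFieldTheory.Balaban1983to89.B2Prop31MinimizerFamilyK

end
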